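import Summits.Ventures.MM22.Rank333.Root21Kernel
import Summits.Ventures.MM22.Rank333.RankGe21Transport
import Summits.MatrixMultiplication.OmegaCensus.SmallFormats.RankRowIncrement
import HarnessLib

/-!
# MM22 venture — UNCONDITIONAL readings of `21 ≤ R_{𝔽₂}(⟨3,3,3⟩)`: bilinear computations, Brent equations, `ℤ`, `ℤ/2ᵏ`, two-element fields

HONEST FRAMING (cell `pub-mm22`, seat LIT-2 g10). No new mathematics: this file applies the CONDITIONAL transports of
`RankGe21Transport.lean` (`RankGe21F2.of_ringHom`, `.int`, `.window_int`, `.zmod_two_pow`, `.card_two`, `.window_F2`;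
Bläser 1999 §5 eq. (10) map lemma `tensorRank_matMulTensor_map_le` + Laderman 1976) to the cell's kernel theorem
`rankGe21F2_holds : RankGe21F2` (`Root21Kernel.lean`: the root PROFILE-certificate replay + the eight kernel lift
certificates), exactly as `Wang333RankTransport.lean` did for Wang's printed `20`.

READINGS: in Bläser's language (2003, Def. 1; tree `BilinComp (mulBilin k 3 3 3) ι`) every bilinear computation of `3 × 3` matrix
multiplication over `𝔽₂` has at least `21` products (`twentyone_le_card_of_bilinComp_three_F2`, via the census bridge
`RankRowIncrement.tensorRank_le_card`; none with `20`: `isEmpty_bilinComp_three_F2_twenty`); in the Brent-equation language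
(HKS 2021 §2; tree `brentSystem`) the system `B(3,20)` has no solution over `𝔽₂` (`brent_three_twenty_unsat_F2`, via
`rankGe21F2_iff_brent_unsat`); over `ℤ` there is no bilinear algorithm for `3 × 3` matrix multiplication with integer coefficients and `≤ 20`
non-scalar multiplications (`twentyone_le_tensorRank_matMulTensor_three_int`, `not_tensorRank_matMulTensor_three_int_le_twenty`),
so `21 ≤ R_ℤ(⟨3,3,3⟩) ≤ 23` (`window333_int_21`); the same over `ℤ/2ᵏ` (`k ≥ 1`), over every field with two elements, and
over every commutative semiring with a ring homomorphism onto `𝔽₂`; `window333_F2_21 : 21 ≤ R_{𝔽₂}(⟨3,3,3⟩) ≤ 23`.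

SCOPE (as proved; unchanged from the `20`-transport): `𝔽₂`-specific — nothing follows over `ℚ`, `ℝ`, `ℂ`, `𝔽₃`, …
(no homomorphism to `𝔽₂`), where the tree's bound stays Bläser's `19` (`blaser2003_cor9_holds`); border rank untouched.
-/

namespace Summit.Ventures.MM22

open Literature.Computability.AlgebraicComplexity
open MvPolynomial

/-- **Every bilinear computation of `3 × 3` matrix multiplication over `𝔽₂` has at least `21` products** (bilinear
computations in the sense of Bläser 2003, Def. 1 = tree `BilinComp (mulBilin k c m n) ι`; rank = bilinear complexity via the
census bridge `RankRowIncrement.tensorRank_le_card`). [cite: Blaser2003, Def. 1] -/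
theorem twentyone_le_card_of_bilinComp_three_F2 {ι : Type*} [Fintype ι]
    (β : BilinComp (mulBilin (ZMod 2) 3 3 3) ι) : 21 ≤ Fintype.card ι :=
  le_trans (by simpa [RankGe21F2] using rankGe21F2_holds)
    (Summit.MatrixMultiplication.OmegaCensus.RankRowIncrement.tensorRank_le_card β)

/-- Reading: there is NO bilinear computation of `3 × 3` matrix multiplication over `𝔽₂` with `20` products.
[cite: Blaser2003, Def. 1] -/
theorem isEmpty_bilinComp_three_F2_twenty : IsEmpty (BilinComp (mulBilin (ZMod 2) 3 3 3) (Fin 20)) :=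
  ⟨fun β => by have h := twentyone_le_card_of_bilinComp_three_F2 β; simp at h⟩

/-- **Brent-equation reading: the Brent system `B(3,20)` (`729` cubic equations in `540` unknowns) has no solution
over `𝔽₂`** (`rankGe21F2_iff_brent_unsat`). [cite: HeuleKauersSeidl2021, §2 (the Brent equations)] -/
theorem brent_three_twenty_unsat_F2 :
    ¬ ∃ x : Fin 3 × Fin 20 × (Fin 3 × Fin 3) → ZMod 2,
      ∀ i j k, eval x (brentSystem (ZMod 2) 3 20 i j k) = 0 :=
  rankGe21F2_iff_brent_unsat.1 rankGe21F2_holds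

/-- **`21 ≤ R_R(⟨3,3,3⟩)` for every commutative semiring `R` with a ring homomorphism `R → 𝔽₂`.**
[cite: Blaser1999, §5 eq. (10)] -/
theorem twentyone_le_tensorRank_matMulTensor_three_of_ringHom {R : Type*} [CommSemiring R]
    (f : R →+* ZMod 2) : 21 ≤ tensorRank (matMulTensor R 3 3 3) :=
  rankGe21F2_holds.of_ringHom f

/-- **Over the integers: `21 ≤ R_ℤ(⟨3,3,3⟩)`** — no `3 × 3` scheme with integer coefficients and `≤ 20` products.
[cite: Blaser1999, §5 eq. (10)] -/
theorem twentyone_le_tensorRank_matMulTensor_three_int : 21 ≤ tensorRank (matMulTensor ℤ 3 3 3) :=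
  rankGe21F2_holds.int

/-- Reading: no integer `3 × 3` scheme with `20` (or fewer) products. -/
theorem not_tensorRank_matMulTensor_three_int_le_twenty : ¬ tensorRank (matMulTensor ℤ 3 3 3) ≤ 20 :=
  rankGe21F2_holds.not_le_twenty_int

/-- **The integer window: `21 ≤ R_ℤ(⟨3,3,3⟩) ≤ 23`** (Laderman 1976 for the upper end). [cite: Laderman1976, p. 126] -/
theorem window333_int_21 :
    21 ≤ tensorRank (matMulTensor ℤ 3 3 3) ∧ tensorRank (matMulTensor ℤ 3 3 3) ≤ 23 :=
  rankGe21F2_holds.window_int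

/-- **Over `ℤ/2ᵏ`, `k ≥ 1`: `21 ≤ R_{ℤ/2ᵏ}(⟨3,3,3⟩)`** (every Hensel stage of a `𝔽₂` scheme). [cite: Blaser1999, §5 eq. (10)] -/
theorem twentyone_le_tensorRank_matMulTensor_three_zmod_two_pow {k : ℕ} (hk : 1 ≤ k) :
    21 ≤ tensorRank (matMulTensor (ZMod (2 ^ k)) 3 3 3) :=
  rankGe21F2_holds.zmod_two_pow hk

/-- **Over every field with two elements: `21 ≤ R_F(⟨3,3,3⟩)`.** [cite: Blaser1999, §5 eq. (10)] -/
theorem twentyone_le_tensorRank_matMulTensor_three_of_card_two (F : Type*) [Field F] [Fintype F]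
    (hF : Fintype.card F = 2) : 21 ≤ tensorRank (matMulTensor F 3 3 3) :=
  rankGe21F2_holds.card_two F hF

/-- **The `𝔽₂` window: `21 ≤ R_{𝔽₂}(⟨3,3,3⟩) ≤ 23`.** [cite: Laderman1976, p. 126] -/
theorem window333_F2_21 :
    21 ≤ tensorRank (matMulTensor (ZMod 2) 3 3 3) ∧ tensorRank (matMulTensor (ZMod 2) 3 3 3) ≤ 23 :=
  rankGe21F2_holds.window_F2

end Summit.Ventures.MM22
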